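import Summits.PneNP.PneNP.Theses.OverlapGapAlgebra
import Summits.PneNP.PneNP.Theorems.OverlapGapAlgebraSearchHardWindowFromTransfer
import Summits.PneNP.PneNP.Theorems.OverlapGapAlgebraPositiveSatProbability
import Literature.Computability.Complexity.RandomKSatWeights
import Literature.Computability.Complexity.RandomKSatUniformlyPos

/-!
# Sketch for crux idea `quiet-planting-oneway-bridge` (crux stmt-PneNP-2463, `SolvableImpliesStableSection`)

Round 2, ideator 4 (planner-cruxidea-stmt-PneNP-2463-4-0), 2026-08-16.

The lever: QUIET PLANTING (Achlioptas–Peres balanced weights `X₊ = balancedCount λ`, already in the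
tree as `Literature.Computability.Complexity.RandomKSat.balancedCount`) turns the crux's window form
`¬PolySolvable(k, α_k)` into the (strong) ONE-WAYNESS of an explicit NC⁰-samplable function — the
balanced planted `k`-SAT sampler `(σ, clause coins) ↦ Φ`, whose instance law is `∝ X₊(Φ)` and whose
inversion IS "find any satisfying assignment".  Two elementary finite transfer inequalities carry success
probabilities between the uniform and the planted instance laws:

* `plantedMass_ge` (uniform ⇒ planted, needs a LOWER TAIL of `X₊` at constant scale): a set of
  instances of uniform density `ε` off which `X₊` is rarely small carries planted mass `≥ ε t / 2`;
* `card_ge_of_plantedMass` (planted ⇒ uniform, needs only the SECOND MOMENT `N Σ X₊² ≤ C (Σ X₊)²`,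
  which is what `achlioptasPeres2004_uniformlyPos` establishes): planted mass `c` forces uniform density
  `≥ c²/(4C)`.

Consequences stated below (definitions verbatim over the crux's objects):
* `notPolySolvable_of_plantedHard` : `StrongPlantedHard k α λ → LowerTailTight k α λ → ¬ PolySolvable k α`;
* `plantedHard_of_notPolySolvable` : `SecondMomentRatio k α λ C → ¬ PolySolvable k α → StrongPlantedHard k α λ`;
* `windowHard_of_planted`, `searchHardWindow_of_windowHard` : the window form reaches the route target
  `SearchHardWindow` (item 2460) through the tree theorem `searchHardWindow_of_windowTransfer'`.
-/

set_option linter.dupNamespace false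

noncomputable section

namespace Summit.PneNP.PneNP.Cruxes.SolvableImpliesStableSection.QuietPlanting

open Finset Filter
open scoped Classical
open Literature.Computability.Complexity.RandomKSat (balancedCount)

/-! ### §1. Two abstract transfer inequalities (finite probability, sorry-free targets) -/

section Abstract

variable {ι : Type*} [Fintype ι]

/-- **Planted ⇒ uniform (upper-tail / second-moment form).** If nonnegative weights `w` on a finite
set have second moment `N · Σ w² ≤ C · (Σ w)²` and a set `A` carries a `c`-fraction of the total
weight, then `A` has uniform density at least `c² / (4C)`.  (Markov on `w²` above the level
`T μ`, `T = 2C/c`, `μ = Σ w / N`, removes at most half of `A`'s weight; the rest sits on points of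
weight `≤ T μ`, hence needs `≥ c N/(2T)` points.) -/
theorem card_ge_of_plantedMass (w : ι → ℝ) (_hw : ∀ i, 0 ≤ w i) (A : Finset ι) {C c : ℝ}
    (hC : 0 < C) (hc : 0 < c) (hS : 0 < ∑ i, w i)
    (hsecond : (Fintype.card ι : ℝ) * ∑ i, w i ^ 2 ≤ C * (∑ i, w i) ^ 2)
    (hmass : c * ∑ i, w i ≤ ∑ i ∈ A, w i) :
    c ^ 2 / (4 * C) * Fintype.card ι ≤ A.card := by
  set S : ℝ := ∑ i, w i with hSdef
  set N : ℝ := (Fintype.card ι : ℝ) with hNdef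
  have hN : 0 < N := by
    have : Nonempty ι := by
      by_contra h
      rw [not_nonempty_iff] at h
      have : S = 0 := by
        rw [hSdef]; exact Finset.sum_eq_zero fun i _ => (IsEmpty.false i).elim
      linarith
    rw [hNdef]; exact_mod_cast Fintype.card_pos
  set μ : ℝ := S / N with hμ
  have hμpos : 0 < μ := div_pos hS hN
  set T : ℝ := 2 * C / c with hT
  have hTpos : 0 < T := by positivity
  -- split `A` at the level `T μ`
  set B : Finset ι := A.filter fun i => w i ≤ T * μ with hB
  set B' : Finset ι := A.filter fun i => ¬ (w i ≤ T * μ) with hB'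
  have hsplit : ∑ i ∈ A, w i = ∑ i ∈ B, w i + ∑ i ∈ B', w i :=
    (Finset.sum_filter_add_sum_filter_not A (fun i => w i ≤ T * μ) w).symm
  -- the heavy part is small: Σ_{w > Tμ} w ≤ Σ w²/(Tμ) ≤ (C S²/N)/(Tμ) = (c/2) S
  have hheavy : ∑ i ∈ B', w i ≤ c / 2 * S := by
    have h1 : ∑ i ∈ B', w i ≤ ∑ i ∈ B', w i ^ 2 / (T * μ) := by
      refine Finset.sum_le_sum fun i hi => ?_
      have hi' : T * μ < w i := by
        simp only [hB', Finset.mem_filter] at hi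
        exact lt_of_not_ge hi.2
      have hwi : 0 < w i := lt_trans (by positivity) hi'
      rw [le_div_iff₀ (by positivity), sq]
      exact mul_le_mul_of_nonneg_left hi'.le hwi.le
    have h2 : ∑ i ∈ B', w i ^ 2 / (T * μ) ≤ (∑ i, w i ^ 2) / (T * μ) := by
      rw [← Finset.sum_div]
      refine div_le_div_of_nonneg_right ?_ (by positivity)
      exact Finset.sum_le_univ_sum_of_nonneg fun i => sq_nonneg (w i)
    have h3 : (∑ i, w i ^ 2) ≤ C * S ^ 2 / N := by
      rw [le_div_iff₀ hN]; linarith [hsecond]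
    have h4 : C * S ^ 2 / N / (T * μ) = c / 2 * S := by
      rw [hT, hμ]
      field_simp
    calc ∑ i ∈ B', w i ≤ (∑ i, w i ^ 2) / (T * μ) := h1.trans h2
      _ ≤ C * S ^ 2 / N / (T * μ) := div_le_div_of_nonneg_right h3 (by positivity)
      _ = c / 2 * S := h4
  -- hence the light part carries half the mass
  have hlight : c / 2 * S ≤ ∑ i ∈ B, w i := by linarith
  -- and the light part is at most `|B| · T μ ≤ |A| · T μ`
  have hBcard : ∑ i ∈ B, w i ≤ (A.card : ℝ) * (T * μ) := by
    calc ∑ i ∈ B, w i ≤ ∑ _i ∈ B, T * μ := Finset.sum_le_sum fun i hi => by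
            simp only [hB, Finset.mem_filter] at hi
            exact hi.2
      _ = (B.card : ℝ) * (T * μ) := by rw [Finset.sum_const, nsmul_eq_mul]
      _ ≤ (A.card : ℝ) * (T * μ) := by
            refine mul_le_mul_of_nonneg_right ?_ (by positivity)
            exact_mod_cast Finset.card_filter_le A _
  -- conclude
  have key : c / 2 * S ≤ (A.card : ℝ) * (T * μ) := hlight.trans hBcard
  have e : (A.card : ℝ) * (T * μ) = (A.card : ℝ) * (2 * C / c) * S / N := by
    rw [hT, hμ]; ring
  rw [e, le_div_iff₀ hN] at key
  -- `c/2 · S · N ≤ |A| · (2C/c) · S`; cancel `S > 0`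
  have key' : c / 2 * N ≤ (A.card : ℝ) * (2 * C / c) := by
    have := key
    nlinarith [hS, this]
  rw [div_mul_eq_mul_div, div_le_iff₀ (by positivity)]
  have : c ^ 2 * N ≤ (A.card : ℝ) * (4 * C) := by
    have h := mul_le_mul_of_nonneg_left key' hc.le
    have e2 : c * ((A.card : ℝ) * (2 * C / c)) = (A.card : ℝ) * (2 * C) := by
      field_simp
    rw [e2] at h
    nlinarith [h]
  linarith

/-- **Uniform ⇒ planted (lower-tail form).** If `A` has uniform density `≥ ε` and the weight `w` is
below `t μ` (`μ` = mean weight) on at most an `ε/2`-fraction of all points, then `A` carries at least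
an `ε t / 2`-fraction of the total weight. -/
theorem plantedMass_ge (w : ι → ℝ) (hw : ∀ i, 0 ≤ w i) (A : Finset ι) {ε t : ℝ} (ht : 0 ≤ t)
    (hA : ε * Fintype.card ι ≤ A.card)
    (htail : ((univ.filter fun i => w i < t * ((∑ j, w j) / Fintype.card ι)).card : ℝ) ≤
      ε / 2 * Fintype.card ι) :
    ε / 2 * t * ∑ i, w i ≤ ∑ i ∈ A, w i := by
  set S : ℝ := ∑ j, w j with hSdef
  set N : ℝ := (Fintype.card ι : ℝ) with hNdef
  set μ : ℝ := S / N with hμ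
  set L : Finset ι := univ.filter fun i => w i < t * μ with hL
  set A' : Finset ι := A.filter fun i => t * μ ≤ w i with hA'
  -- `|A'| ≥ |A| - |L| ≥ ε N / 2`
  have hcardA' : ε / 2 * N ≤ (A'.card : ℝ) := by
    have hsub : A \ L ⊆ A' := by
      intro i hi
      simp only [Finset.mem_sdiff, hL, Finset.mem_filter, Finset.mem_univ, true_and, not_lt] at hi
      simp only [hA', Finset.mem_filter]
      exact ⟨hi.1, hi.2⟩
    have h1 : ((A \ L).card : ℝ) ≤ A'.card := by exact_mod_cast Finset.card_le_card hsub
    have h2 : (A.card : ℝ) - L.card ≤ ((A \ L).card : ℝ) := by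
      have := Finset.le_card_sdiff L A
      have h' : A.card - L.card ≤ (A \ L).card := this
      have : ((A.card - L.card : ℕ) : ℝ) ≤ ((A \ L).card : ℝ) := by exact_mod_cast h'
      calc (A.card : ℝ) - L.card ≤ ((A.card - L.card : ℕ) : ℝ) := by
              rw [sub_le_iff_le_add]; exact_mod_cast le_tsub_add
        _ ≤ _ := this
    have h3 : (L.card : ℝ) ≤ ε / 2 * N := htail
    linarith
  -- `Σ_A w ≥ Σ_{A'} w ≥ |A'| t μ`
  have hsum : (A'.card : ℝ) * (t * μ) ≤ ∑ i ∈ A, w i := by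
    calc (A'.card : ℝ) * (t * μ) = ∑ _i ∈ A', t * μ := by rw [Finset.sum_const, nsmul_eq_mul]
      _ ≤ ∑ i ∈ A', w i := Finset.sum_le_sum fun i hi => by
            simp only [hA', Finset.mem_filter] at hi
            exact hi.2
      _ ≤ ∑ i ∈ A, w i :=
            Finset.sum_le_sum_of_subset_of_nonneg (Finset.filter_subset _ _) fun i _ _ => hw i
  -- assemble; the degenerate case `N = 0` (empty type) is `0 ≤ 0`-like
  by_cases hN : N = 0
  · have hι : IsEmpty ι := by
      have h0 : (Fintype.card ι : ℝ) = 0 := hN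
      have : Fintype.card ι = 0 := by exact_mod_cast h0
      exact Fintype.card_eq_zero_iff.1 this
    have hS0 : S = 0 := Finset.sum_eq_zero fun i _ => (IsEmpty.false i).elim
    have hA0 : ∑ i ∈ A, w i = 0 := Finset.sum_eq_zero fun i _ => (IsEmpty.false i).elim
    rw [hS0, hA0]; simp
  · have hNpos : 0 < N := lt_of_le_of_ne (by positivity) (Ne.symm hN)
    have hμt : 0 ≤ t * μ := by
      have : 0 ≤ μ := div_nonneg (Finset.sum_nonneg fun i _ => hw i) hNpos.le
      positivity
    calc ε / 2 * t * S = ε / 2 * N * (t * μ) := by rw [hμ]; field_simp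
      _ ≤ (A'.card : ℝ) * (t * μ) := mul_le_mul_of_nonneg_right hcardA' hμt
      _ ≤ ∑ i ∈ A, w i := hsum

end Abstract

/-! ### §2. The crux's objects, the planted mass and the three hypotheses -/

/-- The set of instances `Φ : Fin m → Fin k → Fin n × Bool` solved by the word function `f`
(verbatim the filter of the crux's hypothesis). -/
def solvedSet (k m n : ℕ) (f : List Bool → List Bool) : Finset (Fin m → Fin k → Fin n × Bool) :=
  univ.filter fun Φ : Fin m → Fin k → Fin n × Bool => ∀ i, ∃ j,
    (f (Literature.Computability.Complexity.encodingCNF.encode (List.ofFn fun a =>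
      List.ofFn fun b => (((Φ a b).1 : ℕ), (Φ a b).2)))).getD (Φ i j).1 false = (Φ i j).2

/-- The crux's hypothesis at `(k, α)` (verbatim the antecedent of `SolvableImpliesStableSection`;
same as `Disproof.Solvable`). -/
def PolySolvable (k : ℕ) (α : ℝ) : Prop :=
  ∃ f : List Bool → List Bool, Literature.Computability.Complexity.IsPolyTime f ∧ ∃ ε : ℝ, 0 < ε ∧
    ∃ᶠ n : ℕ in Filter.atTop, ∀ m : ℕ, m = ⌊α * n⌋₊ → ε ≤
      ((Finset.univ.filter fun Φ : Fin m → Fin k → Fin n × Bool => ∀ i, ∃ j,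
        (f (Literature.Computability.Complexity.encodingCNF.encode (List.ofFn fun a =>
          List.ofFn fun b => (((Φ a b).1 : ℕ), (Φ a b).2)))).getD (Φ i j).1 false =
            (Φ i j).2).card : ℝ) / Fintype.card (Fin m → Fin k → Fin n × Bool)

/-- PLANTED SUCCESS of `f`: the fraction of the balanced Achlioptas–Peres weight `X₊ = balancedCount λ`
carried by the instances `f` solves — i.e. the probability that `f` inverts the balanced `λ`-planted
`k`-SAT sampler (instance law `∝ X₊(Φ)`; KMZ12 §4.2 / AP04 §7). -/
def plantedMass (k m n : ℕ) (lam : ℝ) (f : List Bool → List Bool) : ℝ :=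
  (∑ Φ ∈ solvedSet k m n f, balancedCount lam Φ) /
    ∑ Φ : Fin m → Fin k → Fin n × Bool, balancedCount lam Φ

/-- `StrongPlantedHard k α λ`: no polynomial-time word function inverts the balanced `λ`-planted
sampler at density `α` with non-vanishing probability — every `IsPolyTime f` has planted success
`→ 0` (the cryptographic reading of "instability needs algebra" in the window). -/
def StrongPlantedHard (k : ℕ) (α lam : ℝ) : Prop :=
  ∀ f : List Bool → List Bool, Literature.Computability.Complexity.IsPolyTime f → ∀ c : ℝ, 0 < c →
    ∀ᶠ n : ℕ in Filter.atTop, ∀ m : ℕ, m = ⌊α * n⌋₊ → plantedMass k m n lam f ≤ c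

/-- `LowerTailTight k α λ` (f-free, small-subgraph-conditioning type; physics: "quenched = annealed ⇒
quiet planting", KMZ12 §4.1–4.2; rigorous at O(1) scale only for REGULAR k-SAT, Coja-Oghlan–Wormald
2018 Thm 1.1): for every `ε > 0` some constant level `t > 0` has `#{Φ : X₊(Φ) < t · mean X₊} ≤ ε/2 · #Inst`
eventually. -/
def LowerTailTight (k : ℕ) (α lam : ℝ) : Prop :=
  ∀ ε : ℝ, 0 < ε → ∃ t : ℝ, 0 < t ∧ ∀ᶠ n : ℕ in Filter.atTop, ∀ m : ℕ, m = ⌊α * n⌋₊ →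
    ((univ.filter fun Φ : Fin m → Fin k → Fin n × Bool => balancedCount lam Φ <
        t * ((∑ Φ' : Fin m → Fin k → Fin n × Bool, balancedCount lam Φ') /
          Fintype.card (Fin m → Fin k → Fin n × Bool))).card : ℝ) ≤
      ε / 2 * Fintype.card (Fin m → Fin k → Fin n × Bool)

/-- `SecondMomentRatio k α λ C`: the Achlioptas–Peres second moment in counting form,
`#Inst · Σ X₊² ≤ C (Σ X₊)²` with `Σ X₊ > 0`, eventually (what `achlioptasPeres2004_uniformlyPos`
proves on the way to `Pr[sat] ≥ c₇²/C`, for `k ≥ 1024`, `α < ρ_k`, `λ = 1 - ε₀(k)`). -/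
def SecondMomentRatio (k : ℕ) (α lam C : ℝ) : Prop :=
  ∀ᶠ n : ℕ in Filter.atTop, ∀ m : ℕ, m = ⌊α * n⌋₊ →
    0 < ∑ Φ : Fin m → Fin k → Fin n × Bool, balancedCount lam Φ ∧
    (Fintype.card (Fin m → Fin k → Fin n × Bool) : ℝ) *
        ∑ Φ : Fin m → Fin k → Fin n × Bool, balancedCount lam Φ ^ 2 ≤
      C * (∑ Φ : Fin m → Fin k → Fin n × Bool, balancedCount lam Φ) ^ 2

/-- The WINDOW form of the crux (all the route needs, `searchHardWindow_of_windowTransfer'`):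
for all large `k`, random `k`-SAT at `α_k = 5·2^k log k/k` is not polynomial-time solvable with
non-vanishing probability. -/
def WindowHard : Prop :=
  ∃ k₁ : ℕ, ∀ k : ℕ, k₁ ≤ k → ¬ PolySolvable k (5 * 2 ^ k * Real.log k / k)

/-! ### §3. The bridge -/

/-- **(⇐) Planted strong one-wayness + the lower tail ⇒ the window form at `(k, α)`.** -/
theorem notPolySolvable_of_plantedHard (k : ℕ) (α lam : ℝ) (hlam : 0 ≤ lam)
    (hH : StrongPlantedHard k α lam) (hL : LowerTailTight k α lam)
    (hpos : ∀ᶠ n : ℕ in Filter.atTop, ∀ m : ℕ, m = ⌊α * n⌋₊ →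
      0 < ∑ Φ : Fin m → Fin k → Fin n × Bool, balancedCount lam Φ) :
    ¬ PolySolvable k α := by
  rintro ⟨f, hf, ε, hε, hfreq⟩
  obtain ⟨t, ht, htail⟩ := hL ε hε
  have hc : 0 < ε / 2 * t / 2 := by positivity
  have hev := (hH f hf (ε / 2 * t / 2) hc).and (htail.and hpos)
  obtain ⟨n, hn, hsmall, htl, hp⟩ := (hfreq.and_eventually hev).exists
  have h1 := hn _ rfl
  have h2 := hsmall _ rfl
  have h3 := htl _ rfl
  have h4 := hp _ rfl
  -- uniform density `ε` of the solved set
  set A := solvedSet k ⌊α * n⌋₊ n f with hAdef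
  have hcardpos : (0 : ℝ) < Fintype.card (Fin ⌊α * n⌋₊ → Fin k → Fin n × Bool) := by
    rcases Nat.eq_zero_or_pos (Fintype.card (Fin ⌊α * n⌋₊ → Fin k → Fin n × Bool)) with h0 | h0
    · exfalso
      rw [h0, Nat.cast_zero, div_zero] at h1
      linarith
    · exact_mod_cast h0
  have hA : ε * Fintype.card (Fin ⌊α * n⌋₊ → Fin k → Fin n × Bool) ≤ A.card := by
    rw [le_div_iff₀ hcardpos] at h1
    simpa [hAdef, solvedSet] using h1
  -- transfer
  have key := plantedMass_ge (fun Φ => balancedCount lam Φ)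
    (fun Φ => Literature.Computability.Complexity.RandomKSat.balancedCount_nonneg hlam Φ) A ht.le hA h3
  -- contradiction with small planted mass
  have hpm : plantedMass k ⌊α * n⌋₊ n lam f ≤ ε / 2 * t / 2 := h2
  unfold plantedMass at hpm
  rw [div_le_iff₀ h4] at hpm
  have : ε / 2 * t * ∑ Φ : Fin ⌊α * n⌋₊ → Fin k → Fin n × Bool, balancedCount lam Φ ≤
      ε / 2 * t / 2 * ∑ Φ : Fin ⌊α * n⌋₊ → Fin k → Fin n × Bool, balancedCount lam Φ :=
    key.trans hpm
  nlinarith [h4, ht, hε]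

/-- **(⇒) The second moment ⇒ (window hardness ⇒ planted strong one-wayness) at `(k, α)`.**
Planted success `≥ c` infinitely often gives uniform success `≥ c²/(4C)` infinitely often. -/
theorem plantedHard_of_notPolySolvable (k : ℕ) (α lam C : ℝ) (hlam : 0 ≤ lam) (hC : 0 < C)
    (hM : SecondMomentRatio k α lam C) (hW : ¬ PolySolvable k α) :
    StrongPlantedHard k α lam := by
  intro f hf c hc
  by_contra hnot
  -- planted success `> c` frequently
  have hfreq : ∃ᶠ n : ℕ in Filter.atTop, ∃ m : ℕ, m = ⌊α * n⌋₊ ∧ c < plantedMass k m n lam f := by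
    rw [Filter.not_eventually] at hnot
    refine hnot.mono fun n hn => ?_
    push Not at hn
    obtain ⟨m, hm, hlt⟩ := hn
    exact ⟨m, hm, hlt⟩
  apply hW
  refine ⟨f, hf, c ^ 2 / (4 * C), by positivity, ?_⟩
  refine (hfreq.and_eventually hM).mono fun n ⟨⟨m, hm, hlt⟩, hMn⟩ => ?_
  intro m' hm'
  subst hm; subst hm'
  obtain ⟨hS, hsec⟩ := hMn _ rfl
  have hmass : c * ∑ Φ : Fin ⌊α * n⌋₊ → Fin k → Fin n × Bool, balancedCount lam Φ ≤
      ∑ Φ ∈ solvedSet k ⌊α * n⌋₊ n f, balancedCount lam Φ := by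
    unfold plantedMass at hlt
    rw [lt_div_iff₀ hS] at hlt
    exact hlt.le
  have key := card_ge_of_plantedMass (fun Φ => balancedCount lam Φ)
    (fun Φ => Literature.Computability.Complexity.RandomKSat.balancedCount_nonneg hlam Φ)
    (solvedSet k ⌊α * n⌋₊ n f) hC hc hS hsec hmass
  have hcardpos : (0 : ℝ) < Fintype.card (Fin ⌊α * n⌋₊ → Fin k → Fin n × Bool) := by
    rcases Nat.eq_zero_or_pos (Fintype.card (Fin ⌊α * n⌋₊ → Fin k → Fin n × Bool)) with h0 | h0
    · exfalso
      have hE : IsEmpty (Fin ⌊α * n⌋₊ → Fin k → Fin n × Bool) := Fintype.card_eq_zero_iff.1 h0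
      have : ∑ Φ : Fin ⌊α * n⌋₊ → Fin k → Fin n × Bool, balancedCount lam Φ = 0 :=
        Finset.sum_eq_zero fun Φ _ => (IsEmpty.false Φ).elim
      linarith
    · exact_mod_cast h0
  rw [le_div_iff₀ hcardpos]
  simpa [solvedSet] using key

/-- **The window form from planted hardness**: strong one-wayness of the balanced planted sampler plus
the lower tail at `α_k`, for all large `k`, give `WindowHard`. -/
theorem windowHard_of_planted
    (h : ∃ k₁ : ℕ, ∀ k : ℕ, k₁ ≤ k → ∃ lam : ℝ, 0 ≤ lam ∧
      StrongPlantedHard k (5 * 2 ^ k * Real.log k / k) lam ∧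
      LowerTailTight k (5 * 2 ^ k * Real.log k / k) lam ∧
      (∀ᶠ n : ℕ in Filter.atTop, ∀ m : ℕ, m = ⌊5 * 2 ^ k * Real.log k / k * n⌋₊ →
        0 < ∑ Φ : Fin m → Fin k → Fin n × Bool, balancedCount lam Φ)) :
    WindowHard := by
  obtain ⟨k₁, hk⟩ := h
  refine ⟨k₁, fun k hkk => ?_⟩
  obtain ⟨lam, hlam, hH, hL, hpos⟩ := hk k hkk
  exact notPolySolvable_of_plantedHard k _ lam hlam hH hL hpos

/-- **The window form already gives the route target** `SearchHardWindow` (item 2460), through the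
tree theorem `searchHardWindow_of_windowTransfer'` (the transfer's antecedent is refuted outright). -/
theorem searchHardWindow_of_windowHard (h : WindowHard) :
    Summit.PneNP.PneNP.Theses.OverlapGapAlgebra.SearchHardWindow := by
  obtain ⟨k₁, hk⟩ := h
  refine Summit.PneNP.PneNP.Theorems.searchHardWindow_of_windowTransfer' ⟨k₁, ?_⟩
  intro k hkk η ν _ _ hsolv
  exact absurd hsolv (hk k hkk)

/-- Hence the summit from planted hardness in the window (calibration of what the bridge buys). -/
theorem pneNP_of_planted
    (h : ∃ k₁ : ℕ, ∀ k : ℕ, k₁ ≤ k → ∃ lam : ℝ, 0 ≤ lam ∧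
      StrongPlantedHard k (5 * 2 ^ k * Real.log k / k) lam ∧
      LowerTailTight k (5 * 2 ^ k * Real.log k / k) lam ∧
      (∀ᶠ n : ℕ in Filter.atTop, ∀ m : ℕ, m = ⌊5 * 2 ^ k * Real.log k / k * n⌋₊ →
        0 < ∑ Φ : Fin m → Fin k → Fin n × Bool, balancedCount lam Φ)) :
    _root_.PneNP :=
  Summit.PneNP.PneNP.Theorems.overlapGapAlgebra_assembly_proof
    Summit.PneNP.PneNP.Theorems.overlapGap_evalRelationInP
    (searchHardWindow_of_windowHard (windowHard_of_planted h))


/-! ### §4. The (⇒) direction is UNCONDITIONAL in the window: the second moment from the tree -/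

section SecondMoment

open Literature.Computability.Complexity.RandomKSat

/-- **Second moment in counting form** (the chain of `litArraySatProb_ge_of_bounds`, AP04 Lemma 1 +
(50)–(51), re-run to keep the ratio): under the same hypotheses, `Σ X₊ > 0` and
`#Inst · Σ X₊² ≤ (C/c₇²) (Σ X₊)²`. -/
theorem secondMomentRatio_of_bounds {k n m : ℕ} (hn : 1 ≤ n) (hk : 1 ≤ k) {ε₀ : ℝ} (hε0 : 0 < ε₀)
    (hε01 : ε₀ < 1) (hF0h : 0 < pairPoly k (1 - ε₀) (1 / 2)) {c₇ : ℝ} (hc₇ : 0 < c₇)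
    (hbalanced : c₇ * ∑ Φ : Fin m → Fin k → Fin n × Bool, weightedCount (1 - ε₀) Φ ≤
      ∑ Φ : Fin m → Fin k → Fin n × Bool, balancedCount (1 - ε₀) Φ)
    {C : ℝ} (hC : 0 < C)
    (hLap : ∑ z ∈ range (n + 1), (n.choose z : ℝ) *
        (min (pairPoly k (1 - ε₀) (z / n))
            (((1 - ε₀) / (1 - ε₀ / 2)) ^ k * pairPoly k (1 - ε₀ / 2) (z / n)) /
          pairPoly k (1 - ε₀) (1 / 2)) ^ m ≤ C * 2 ^ n) :
    0 < ∑ Φ : Fin m → Fin k → Fin n × Bool, balancedCount (1 - ε₀) Φ ∧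
    (Fintype.card (Fin m → Fin k → Fin n × Bool) : ℝ) *
        ∑ Φ : Fin m → Fin k → Fin n × Bool, balancedCount (1 - ε₀) Φ ^ 2 ≤
      C / c₇ ^ 2 * (∑ Φ : Fin m → Fin k → Fin n × Bool, balancedCount (1 - ε₀) Φ) ^ 2 := by
  have hnpos : (0 : ℝ) < n := by exact_mod_cast hn
  have hl0 : 0 ≤ 1 - ε₀ := by linarith
  have hl1 : 0 < 1 - ε₀ / 2 := by linarith
  set F0h := pairPoly k (1 - ε₀) (1 / 2) with hF0hdef
  set Ssum := ∑ Φ : Fin m → Fin k → Fin n × Bool, weightedCount (1 - ε₀) Φ with hSsum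
  set Splus := ∑ Φ : Fin m → Fin k → Fin n × Bool, balancedCount (1 - ε₀) Φ with hSplus
  set Q := ∑ Φ : Fin m → Fin k → Fin n × Bool, balancedCount (1 - ε₀) Φ ^ 2 with hQ
  set q : ℕ → ℝ := fun z => min (pairPoly k (1 - ε₀) (z / n))
      (((1 - ε₀) / (1 - ε₀ / 2)) ^ k * pairPoly k (1 - ε₀ / 2) (z / n)) / F0h with hq
  -- (3) the first moment
  have h3 : Ssum = 2 ^ n * ((n : ℝ) ^ k * ((1 + (1 - ε₀)) ^ k - 1)) ^ m := sum_weightedCount _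
  have hU : ((1 + (1 - ε₀)) ^ k - 1) ^ 2 = 2 ^ k * F0h := (pairPoly_half' k (1 - ε₀)).symm
  -- positivity of the first moment, hence of `Splus`
  have hgrow : 0 < (1 + (1 - ε₀)) ^ k - 1 := by
    have : (1 : ℝ) < (1 + (1 - ε₀)) ^ k := one_lt_pow₀ (by linarith) (by omega)
    linarith
  have hSsum_pos : 0 < Ssum := by rw [h3]; positivity
  have hSplus_pos : 0 < Splus := lt_of_lt_of_le (mul_pos hc₇ hSsum_pos) hbalanced
  refine ⟨hSplus_pos, ?_⟩
  -- (4) the pair sum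
  have h4 : Q ≤ 2 ^ n * ∑ z ∈ range (n + 1), (n.choose z : ℝ) *
      (((n : ℝ) ^ k) ^ m * F0h ^ m * q z ^ m) := by
    have hpair := sum_balancedCount_sq_le (n := n) (k := k) (m := m) hl0
      (show 1 - ε₀ ≤ 1 - ε₀ / 2 by linarith) hl1
    have hpt : ∀ σ τ : Fin n → Bool,
        min ((∑ c : Fin k → Fin n × Bool, clauseWeight (1 - ε₀) σ c * clauseWeight (1 - ε₀) τ c) ^ m)
          (((1 - ε₀) / (1 - ε₀ / 2)) ^ (k * m) *
            (∑ c : Fin k → Fin n × Bool, clauseWeight (1 - ε₀ / 2) σ c * clauseWeight (1 - ε₀ / 2) τ c) ^ m) ≤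
        ((n : ℝ) ^ k) ^ m * F0h ^ m * q (overlap σ τ) ^ m := by
      intro σ τ
      rw [sum_clauseWeight_mul_eq_pairPoly hn, sum_clauseWeight_mul_eq_pairPoly hn, pow_mul, ← mul_pow]
      refine (min_pow_le_pow_min _ _ m).trans (le_of_eq ?_)
      rw [← mul_pow, ← mul_pow]
      congr 1
      have eq : F0h * q (overlap σ τ) = min (pairPoly k (1 - ε₀) (overlap σ τ / n))
          (((1 - ε₀) / (1 - ε₀ / 2)) ^ k * pairPoly k (1 - ε₀ / 2) (overlap σ τ / n)) := by
        simp only [hq]; rw [mul_div_cancel₀ _ hF0h.ne']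
      rw [mul_assoc, eq, mul_min_of_nonneg _ _ (by positivity : (0 : ℝ) ≤ (n : ℝ) ^ k)]
      congr 1; ring
    calc Q ≤ _ := hpair
      _ ≤ ∑ σ : Fin n → Bool, ∑ τ : Fin n → Bool, ((n : ℝ) ^ k) ^ m * F0h ^ m * q (overlap σ τ) ^ m :=
          Finset.sum_le_sum fun σ _ => Finset.sum_le_sum fun τ _ => hpt σ τ
      _ = _ := sum_sum_overlap (fun z => ((n : ℝ) ^ k) ^ m * F0h ^ m * q z ^ m)
  -- (5) the Laplace bound
  have h5 : ∑ z ∈ range (n + 1), (n.choose z : ℝ) * (((n : ℝ) ^ k) ^ m * F0h ^ m * q z ^ m) ≤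
      ((n : ℝ) ^ k) ^ m * F0h ^ m * (C * 2 ^ n) := by
    have e : ∑ z ∈ range (n + 1), (n.choose z : ℝ) * (((n : ℝ) ^ k) ^ m * F0h ^ m * q z ^ m) =
        ((n : ℝ) ^ k) ^ m * F0h ^ m * ∑ z ∈ range (n + 1), (n.choose z : ℝ) * q z ^ m := by
      rw [Finset.mul_sum]; refine Finset.sum_congr rfl fun z _ => ?_; ring
    rw [e]
    exact mul_le_mul_of_nonneg_left hLap (by positivity)
  -- (6) combine: `N · Q ≤ C · Ssum² ≤ (C/c₇²) Splus²`
  have hcard : (Fintype.card (Fin m → Fin k → Fin n × Bool) : ℝ) = 2 ^ (k * m) * ((n : ℝ) ^ k) ^ m := by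
    simp only [Fintype.card_fun, Fintype.card_fin, Fintype.card_prod, Fintype.card_bool]
    push_cast
    ring
  set A : ℝ := (1 + (1 - ε₀)) ^ k - 1 with hA
  have hAm : (A ^ m) ^ 2 = 2 ^ (k * m) * F0h ^ m := by
    rw [← pow_mul, show m * 2 = 2 * m from mul_comm _ _, pow_mul, hU, mul_pow, ← pow_mul]
  have hS2 : Ssum ^ 2 = (2 ^ (k * m) * ((n : ℝ) ^ k) ^ m) * ((2 ^ n) ^ 2 * ((n : ℝ) ^ k) ^ m * F0h ^ m) := by
    rw [h3]
    calc (2 ^ n * ((n : ℝ) ^ k * A) ^ m) ^ 2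
        = (2 ^ n) ^ 2 * (((n : ℝ) ^ k) ^ m) ^ 2 * ((A ^ m) ^ 2) := by ring
      _ = _ := by rw [hAm]; ring
  have hNQ : (2 ^ (k * m) * ((n : ℝ) ^ k) ^ m) * Q ≤ C * Ssum ^ 2 := by
    have hN0 : (0 : ℝ) ≤ 2 ^ (k * m) * ((n : ℝ) ^ k) ^ m := by positivity
    calc (2 ^ (k * m) * ((n : ℝ) ^ k) ^ m) * Q
        ≤ (2 ^ (k * m) * ((n : ℝ) ^ k) ^ m) * (2 ^ n * (((n : ℝ) ^ k) ^ m * F0h ^ m * (C * 2 ^ n))) :=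
          mul_le_mul_of_nonneg_left (h4.trans (mul_le_mul_of_nonneg_left h5 (by positivity))) hN0
      _ = C * Ssum ^ 2 := by rw [hS2]; ring
  have hSS : Ssum ^ 2 ≤ Splus ^ 2 / c₇ ^ 2 := by
    rw [le_div_iff₀ (by positivity), ← mul_pow]
    have : Ssum * c₇ ≤ Splus := by linarith [hbalanced]
    exact pow_le_pow_left₀ (by positivity) this 2
  rw [hcard]
  calc (2 ^ (k * m) * ((n : ℝ) ^ k) ^ m) * Q ≤ C * Ssum ^ 2 := hNQ
    _ ≤ C * (Splus ^ 2 / c₇ ^ 2) := mul_le_mul_of_nonneg_left hSS hC.le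
    _ = C / c₇ ^ 2 * Splus ^ 2 := by ring

/-- **The second moment holds in the window** for every `k ≥ 1024` (AP04 via the tree:
`domination`, `exists_sum_balancedCount_ge`, `sum_choose_mul_pow_le_two_pow`, and
`positiveSatProbability_window_density_lt_rho` for `α_k < ρ_k`). -/
theorem secondMomentRatio_window {k : ℕ} (hk : 1024 ≤ k) :
    ∃ lam C : ℝ, 0 ≤ lam ∧ 0 < C ∧ SecondMomentRatio k (5 * 2 ^ k * Real.log k / k) lam C := by
  obtain ⟨ε₀, hε0, hε01, _, hbal', _, _, hF0h, κ, hκ0, hdom⟩ := domination hk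
  obtain ⟨c₇, hc₇, hbalanced⟩ :=
    exists_sum_balancedCount_ge (k := k) (by omega) (lam := 1 - ε₀) (by linarith) hbal'
  obtain ⟨C, hC, hLap⟩ := Literature.Combinatorics.sum_choose_mul_pow_le_two_pow hκ0
  have hρ := Summit.PneNP.PneNP.Theorems.positiveSatProbability_window_density_lt_rho hk
  set r : ℝ := 5 * 2 ^ k * Real.log k / k with hr
  have hr0 : 0 ≤ r := by
    have hk1 : (1 : ℝ) ≤ k := by exact_mod_cast (show 1 ≤ k by omega)
    have : 0 ≤ Real.log k := Real.log_nonneg hk1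
    rw [hr]; positivity
  refine ⟨1 - ε₀, C / c₇ ^ 2, by linarith, by positivity, ?_⟩
  filter_upwards [eventually_ge_atTop 1] with n hn
  intro m hm
  subst hm
  apply secondMomentRatio_of_bounds hn (by omega) hε0 hε01 hF0h hc₇ (hbalanced n _ hn) hC
  have hnpos : (0 : ℝ) < n := by exact_mod_cast hn
  apply hLap n ⌊r * n⌋₊ r hr0 (Nat.floor_le (by positivity))
  intro z hz
  have hz1 : (z : ℝ) / n ≤ 1 := by rw [div_le_one hnpos]; exact_mod_cast hz
  obtain ⟨h0, h1⟩ := hdom r hr0 hρ.le ((z : ℝ) / n) (by positivity) hz1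
  refine ⟨h0, ?_⟩
  have e : 2 * ((z : ℝ) / n) - 1 = (2 * z - n) / n := by field_simp
  rw [e] at h1
  exact h1

/-- **Calibration (⇒), unconditional**: for every `k ≥ 1024`, if random `k`-SAT at the window density
is hard for polynomial time (the crux's window form at `k`), then the balanced planted sampler at
`λ = 1 - ε₀(k)` is STRONGLY one-way against polynomial-time word functions
(planted success `→ 0`).  In particular `SolvableImpliesStableSection` (with item 2462, proved) implies
explicit one-way-type hardness — the crux is of cryptographic (Minicrypt) strength, not merely `P ≠ NP`. -/
theorem plantedHard_window_of_notPolySolvable {k : ℕ} (hk : 1024 ≤ k)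
    (hW : ¬ PolySolvable k (5 * 2 ^ k * Real.log k / k)) :
    ∃ lam : ℝ, 0 ≤ lam ∧ StrongPlantedHard k (5 * 2 ^ k * Real.log k / k) lam := by
  obtain ⟨lam, C, hlam, hC, hM⟩ := secondMomentRatio_window hk
  exact ⟨lam, hlam, plantedHard_of_notPolySolvable k _ lam C hlam hC hM hW⟩

end SecondMoment

/-! ### §5. Calibration of the crux itself: `SolvableImpliesStableSection ⇒` planted strong one-wayness -/

section Calibration

open Summit.PneNP.PneNP.Theses.OverlapGapAlgebra

/-- The crux together with `NoStableSection` (item 2462, PROVED: `noStableSection_proof`) gives the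
window form `WindowHard` (this is the glue of `cruxesImplyTarget_proof`, stopped one step earlier). -/
theorem windowHard_of_crux (hNo : NoStableSection) (hSolv : SolvableImpliesStableSection) :
    WindowHard := by
  obtain ⟨k₀, hk₀⟩ := hNo
  refine ⟨max k₀ 3, fun k hk => ?_⟩
  have hk0 : k₀ ≤ k := le_trans (le_max_left _ _) hk
  have hk3 : 3 ≤ k := le_trans (le_max_right _ _) hk
  obtain ⟨η, hη, ν, hν, c, hc, hev⟩ := hk₀ k hk0
  rintro ⟨f, hf, ε', hε', hfreq⟩
  have hk1' : (1 : ℝ) < k := by exact_mod_cast (by omega : 1 < k)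
  have hkpos : (0 : ℝ) < k := by linarith
  have hlog : 0 < Real.log k := Real.log_pos hk1'
  have hα : (0 : ℝ) < 5 * 2 ^ k * Real.log k / k :=
    div_pos (mul_pos (mul_pos (by norm_num) (by positivity)) hlog) hkpos
  have key := hSolv k hk3 (5 * 2 ^ k * Real.log k / k) η ν hα hη hν ⟨f, hf, ε', hε', hfreq⟩
    (c / 2) (half_pos hc)
  refine Filter.frequently_false (Filter.atTop : Filter ℕ)
    ((key.and_eventually (hev.and (Filter.eventually_ge_atTop 1))).mono ?_)
  rintro n ⟨h₁, h₂, hn1⟩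
  obtain ⟨g, hg⟩ := h₁ _ rfl
  have hg' := h₂ _ rfl g
  haveI : NeZero n := ⟨Nat.one_le_iff_ne_zero.1 hn1⟩
  exact Summit.PneNP.PneNP.Theorems.overlapGap_exp_sandwich_false hc hn1 hg hg'

/-- **Calibration theorem (kernel-checked, unconditional).** The crux `SolvableImpliesStableSection`
implies that for all large `k` the balanced planted `k`-SAT sampler at the window density is strongly
one-way against polynomial-time word functions: `∃ k₁ ∀ k ≥ k₁ ∃ λ ≥ 0, StrongPlantedHard k α_k λ`.
(Uses item 2462 `noStableSection_proof` and the Achlioptas–Peres second moment, both in the tree.) -/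
theorem plantedHard_of_crux (hSolv : SolvableImpliesStableSection) :
    ∃ k₁ : ℕ, ∀ k : ℕ, k₁ ≤ k →
      ∃ lam : ℝ, 0 ≤ lam ∧ StrongPlantedHard k (5 * 2 ^ k * Real.log k / k) lam := by
  obtain ⟨k₁, hk₁⟩ := windowHard_of_crux Summit.PneNP.PneNP.Theorems.noStableSection_proof hSolv
  refine ⟨max k₁ 1024, fun k hk => ?_⟩
  exact plantedHard_window_of_notPolySolvable (le_trans (le_max_right _ _) hk)
    (hk₁ k (le_trans (le_max_left _ _) hk))

end Calibration

/-! ## Appendix — sibling card `parallel-peeling-exact-sections` (f-free, BELOW the window)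

Typed objects for the second card: the parallel pure-literal peeling section. One round removes every
alive clause containing a literal that is PURE among the alive clauses (occurs, and its complement does
not); after `R` rounds a variable gets the value of the pure literal that removed its clauses (default
`false`). The section is a deterministic `R`-local rule; it satisfies `Φ` exactly whenever peeling empties
the formula within `R` rounds. The two stubs of that card are stated as `Prop`s. -/

namespace PeelSection

variable {k m n : ℕ}

/-- Literal `ℓ` is pure with respect to the alive clause set `S` of `Φ`: it occurs in some alive clause and
its complement occurs in none. -/
def IsPure (Φ : Fin m → Fin k → Fin n × Bool) (S : Finset (Fin m)) (ℓ : Fin n × Bool) : Prop :=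
  (∃ i ∈ S, ∃ j, Φ i j = ℓ) ∧ ∀ i ∈ S, ∀ j, Φ i j ≠ (ℓ.1, !ℓ.2)

/-- One round of parallel pure-literal peeling: drop every alive clause containing a pure literal. -/
def peelRound (Φ : Fin m → Fin k → Fin n × Bool) (S : Finset (Fin m)) : Finset (Fin m) :=
  S.filter fun i => ¬ ∃ j, IsPure Φ S (Φ i j)

/-- Alive clauses after `R` rounds. -/
def alive (Φ : Fin m → Fin k → Fin n × Bool) (R : ℕ) : Finset (Fin m) :=
  (peelRound Φ)^[R] Finset.univ

/-- The peeling section after `R` rounds: `v ↦ b` if the literal `(v, b)` was pure at some round `t < R`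
(the first such round decides; at a given round at most one polarity of `v` can be pure unless `v` has no
alive occurrence), default `false`. -/
def section_ (Φ : Fin m → Fin k → Fin n × Bool) (R : ℕ) (v : Fin n) : Bool :=
  if h : ∃ t, t < R ∧ ∃ b : Bool, IsPure Φ (alive Φ t) (v, b) then
    decide (IsPure Φ (alive Φ (Nat.find h)) (v, true))
  else false

theorem peelRound_subset (Φ : Fin m → Fin k → Fin n × Bool) (S : Finset (Fin m)) :
    peelRound Φ S ⊆ S := Finset.filter_subset _ _

/-- STUB 1 of the card (f-free; Jiang–Mitzenmacher–Thaler-type doubly-logarithmic round bound, to be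
proved for the two-sided pure-literal process below its threshold `α_pl(k)`, Molloy 2005): with
`R n = ⌈C log log n⌉₊` rounds, peeling empties `F_k(n, ⌊α n⌋)` off an `O(1/n²)` fraction of instances. -/
def PeelTerminates (k : ℕ) (α : ℝ) (R : ℕ → ℕ) : Prop :=
  ∀ᶠ n : ℕ in Filter.atTop, ∀ m : ℕ, m = ⌊α * n⌋₊ →
    (n : ℝ) ^ 2 * ((Finset.univ.filter fun Φ : Fin m → Fin k → Fin n × Bool =>
        (alive Φ (R n)).Nonempty).card : ℝ) ≤ Fintype.card (Fin m → Fin k → Fin n × Bool)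

/-- STUB 2 of the card (deterministic light cone): the `R`-round section moves, under one literal-slot
change, only at variables within factor-graph distance `R` of the changed clause; at instances of
maximum clause-degree `≤ 3 log n` this is `≤ s n := 2 (3 k log n)^{R n}` — `n^{o(1)}` for
`R n = O(log log n)`, inside the budget `s² log³ n = o(n)` of `sissT_concl_of_typLipschitzSolver`. -/
def PeelLightCone (k : ℕ) (α : ℝ) (R : ℕ → ℕ) (s : ℕ → ℝ) : Prop :=
  ∀ᶠ n : ℕ in Filter.atTop, ∀ m : ℕ, m = ⌊α * n⌋₊ → ∀ Φ : Fin m → Fin k → Fin n × Bool,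
    (((Finset.univ : Finset (Fin n)).sup fun v =>
        ((Finset.univ : Finset (Fin m)).filter fun i => ∃ j, (Φ i j).1 = v).card : ℕ) : ℝ)
          ≤ 3 * Real.log n →
      ∀ (a : Fin m) (b : Fin k) (ℓ : Fin n × Bool),
        (hammingDist (section_ Φ (R n)) (section_ (Function.update Φ a (Function.update (Φ a) b ℓ)) (R n)) : ℝ)
          ≤ s n

/-- What the two stubs buy (statement): the crux's CONCLUSION at `(k, α)` for ALL `η, ν > 0` — exactness
makes `ν` free — through the landed typically-Lipschitz transfer, no hypothesis on solvers. -/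
def ExactSectionsBelowPureLiteral (k : ℕ) (α : ℝ) : Prop :=
  ∀ η ν : ℝ, 0 < η → 0 < ν → ∀ c : ℝ, 0 < c → ∃ᶠ n : ℕ in Filter.atTop, ∀ m : ℕ, m = ⌊α * n⌋₊ →
    ∃ g : (Fin m → Fin k → Fin n × Bool) → (Fin n → Bool),
      Real.exp (-(c * n)) * Fintype.card (Fin (k + 1) → Fin m → Fin k → Fin n × Bool) ≤
      ((Finset.univ.filter fun Ψ : Fin (k + 1) → Fin m → Fin k → Fin n × Bool =>
        let P : Fin k → ℕ → Fin m → Fin k → Fin n × Bool :=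
          fun r q a b => if (a : ℕ) * k + b < q then Ψ r.succ a b else Ψ r.castSucc a b
        (∀ r : Fin k, ∀ q ≤ m * k, ((Finset.univ.filter fun i : Fin m =>
          ∀ j, g (P r q) (P r q i j).1 ≠ (P r q i j).2).card : ℝ) ≤ ν * m) ∧
        ∀ r : Fin k, ∀ q < m * k,
          (hammingDist (g (P r q)) (g (P r (q + 1))) : ℝ) ≤ η * n).card : ℝ)

end PeelSection

end Summit.PneNP.PneNP.Cruxes.SolvableImpliesStableSection.QuietPlanting

end
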